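import Summits.QuantumFields.YangMills.Theorems.BalabanUVNodesPortZDTransportGaugeOn
import Summits.QuantumFields.YangMills.Theorems.BalabanUVNodesK0RecordFormatNamesAx
import Literature.MathematicalPhysics.QuantumFieldTheory.Balaban1983to89.Node00.Record12MinimiserSelection

/-!
# NODE O port, row PT-A′ (PTZ-1, gen 2): the (1.19) ∕ (2.16) row of the ZERO-INPUT functional AT THE Ax RECORD, on the [15] Thm 1 domain, over the record's
# canonical transport — `𝓝⁰_{k+1}(W^v) = 𝓝⁰_{k+1}(W)` for small-field `W` in `regSet`, the image clause discharged, the cut-off's lift-invariance supplied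
# by [Ax-2] on the domain

[Balaban1987RG1] = [I] (CMP 109, 1987): (2.16) p. 269 («the expressions in (2.1) are invariant with respect to the gauge transformations of the lattice T₁^{(k+1)}»),
p. 263 L31–33, (2.9) p. 266, (0.13) p. 254; [Balaban1985Variational] = [15]: Thm 1 p. 279, (181) p. 307.

Seat `ymgap-nodeO-port-PTZ-1` g2 (prover, HELPER MODE; `--supports stmt-QuantumFields-26648 --as helper`; NO `--workitem`).  RECORD INSTANCE of gen 2's
`…PortZDTransportGaugeOn` §2 (`PortZD.zeroInputMergedTermT_gaugeAct_on_Tcan`) at the record's tokens: transport `TβOfRecord₁₃ = TcanOfRecord`, cut-off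
`chiβOfRecord₁₃Ax θ = chiFixed29Ax θ.ν θ.ε₂₉` ([Ax-3]), radius `θ.εbg`, for `θ := thetaFill F a₀ ε₂₉` (`θ.εbg = θ.ν.εreg = a₀`, `rfl`), on the domain `D := {W | |W(∂p) − 1| < ε₁ ∀p}`
of the [15] Thm 1 token TokE of the signed texts (`PlaqSmall ε₁ V → UkExists … a₀ V ∧ UniqueUkOrbit … a₀ V` at level `k + 1` on `T_K`).

WHAT IS PROVED (0 sorry; no `def` ∕ `instance` ∕ `notation`):
* `chiβOfRecord₁₃Ax_liftInvariantOn_of_tokE` — on `avg⁻¹ D` the record's cut-off is lift-invariant (`Node00.chiFixed29Ax_gaugeAct_liftTransf`, its two [B11] clauses read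
  off TokE at `V̄` and at `V̄^v ∈ D` — `D` is gauge-stable, `plaqSmall_gaugeAct_iff'`).
* ★★ `recordZeroInput_gaugeAct_on_of_tokE` — for `k < K`, `0 < ε₁`, TokE at `(K, k+1, a₀, ε₁)`, the zero-input density `χ_k e^{−GF_k∕g_k² + A⁰_k}` integrable (DISPLAYED), every
  coarse `v` and every small-field `W` (`PlaqSmall ε₁ W`) in `regSetOfRecord K k (that density)` (DISPLAYED — K0e's (F1)–(F3) species):
  `𝓝⁰_{k+1}(W^v) = 𝓝⁰_{k+1}(W)` for the record's `ZeroInput.zeroInputMergedTermT F 2 (TβOfRecord₁₃ F 2) (chiβOfRecord₁₃Ax F 2 θ) θ.εbg K g k` — the functional whose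
  exp-chart is the signed (Z) slot `recordΦzAx` (`PortZDRecord.recordΦzAx_eq_stepOutT`).
HONEST FRAMING.  An instance of generic bookkeeping; TokE, integrability and `regSet`-membership are DISPLAYED hypotheses, none discharged; NOTHING of Bałaban's
estimates asserted, ported or discharged; 26648 ∕ 27930⁸ SIGNED·OPEN (content-gated), 27931 under CLOSE HOLD, 27932 CLOSED; K0⁷ ∕ K-Ax OPEN; counts unmoved; finite
𝕋⁴ at fixed ε — NOT continuum ∕ OS ∕ Clay; the Yang–Mills mass gap is NOT proved by any of this.
-/

noncomputable section

open MeasureTheory Set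

namespace Summit.QuantumFields.YangMills.Theorems.PortZDRecord

open Literature.MathematicalPhysics.QuantumFieldTheory.Balaban1983to89
open Literature.MathematicalPhysics.QuantumFieldTheory.Balaban1983to89.Node00
open Literature.MathematicalPhysics.QuantumFieldTheory.Balaban1983to89.T4Continuum (T4Family)
open Summit.QuantumFields.YangMills.Theorems.K0RecordFormatNames
open B12Eq019ActionBody (integrand)
open B12RTGaugeInvariance254 (liftTransf)
open GaugeField (gaugeAct)

variable (F : T4Family) (a₀ ε₂₉ : ℝ)

/-- **ON THE [15] Thm 1 DOMAIN THE RECORD'S CUT-OFF IS LIFT-INVARIANT** (any `θ`; radius `θ.ν.εreg`): with TokE at `(K, k+1, θ.ν.εreg, ε₁)` and `D := {PlaqSmall ε₁}`, for every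
fine `V` with `V̄ ∈ D` and every coarse `v`: `χ^{(2.9)}_{k,ax}(V^{ṽ}) = χ^{(2.9)}_{k,ax}(V)` ([Ax-2]'s `chiFixed29Ax_gaugeAct_liftTransf`; the [B11] clauses at `V̄` and at
`V̄^v ∈ D`, the class `D` being gauge invariant). [cite: Balaban1987RG1, (2.9) p.266, (2.16) p.269; Balaban1985Variational, Thm 1 p.279, (181) p.307] -/
theorem chiβOfRecord₁₃Ax_liftInvariantOn_of_tokE (θ : Stage13Params F 2) {K k : ℕ} (hk : k + 1 ≤ (F.P K).m + (F.P K).K) {ε₁ : ℝ}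
    (hTokE : ∀ V : GaugeField (F.P K) (k + 1) (SU 2), PlaqSmall ε₁ V →
      UkExists F 2 K (k + 1) θ.ν.εreg V ∧ UniqueUkOrbit F 2 K (k + 1) θ.ν.εreg V)
    (g : ℕ → ℝ) (v : GaugeTransf (F.P K) (k + 1) (SU 2)) (V : GaugeField (F.P K) k (SU 2))
    (hV : (avOfRecord F 2 K k).avg V ∈ {W : PBond (F.P K) (k + 1) → SU 2 | PlaqSmall ε₁ W}) :
    chiβOfRecord₁₃Ax F 2 θ K g k (gaugeAct (liftTransf v) V) = chiβOfRecord₁₃Ax F 2 θ K g k V := by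
  have hV' : PlaqSmall ε₁ ((avOfRecord F 2 K k).avg V) := hV
  have hvV : PlaqSmall ε₁ (gaugeAct v ((avOfRecord F 2 K k).avg V)) := (B12GaugeOrbits021.plaqSmall_gaugeAct_iff' ε₁ v _).2 hV'
  exact chiFixed29Ax_gaugeAct_liftTransf θ.ε₂₉ hk g v V (hTokE _ hV').1 (hTokE _ hvV).2

/-- ★★ **(2.16) FOR THE ZERO-INPUT FUNCTIONAL OF RECORD, ON THE [15] Thm 1 DOMAIN, OVER THE CANONICAL TRANSPORT — IMAGE CLAUSE DISCHARGED**: `θ := thetaFill F a₀ ε₂₉`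
(`θ.εbg = θ.ν.εreg = a₀`), `k < K`; TokE at `(K, k+1, a₀, ε₁)`; the zero-input density `χ_k e^{−GF_k∕g_k² + A⁰_k}` integrable (displayed); then for every coarse `v`
and every `W` with `PlaqSmall ε₁ W` and `W ∈ regSetOfRecord K k (χ_k e^{−GF_k∕g_k² + A⁰_k})` (displayed): `𝓝⁰_{k+1}(W^v) = 𝓝⁰_{k+1}(W)`.
[cite: Balaban1987RG1, (2.16) p.269, (1.19) p.263, (0.13) p.254; Balaban1985Variational, Thm 1 p.279] -/
theorem recordZeroInput_gaugeAct_on_of_tokE {K k : ℕ} (hk : k < K) {ε₁ : ℝ} (g : ℕ → ℝ)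
    (hTokE : ∀ V : GaugeField (F.P K) (k + 1) (SU 2), PlaqSmall ε₁ V → UkExists F 2 K (k + 1) a₀ V ∧ UniqueUkOrbit F 2 K (k + 1) a₀ V)
    (hρ : Integrable
      (integrand (chiβOfRecord₁₃Ax F 2 (thetaFill F a₀ ε₂₉) K g k) (gfOfRecord F 2 K k) (g k)
        (ZeroInput.mainTermT F 2 (thetaFill F a₀ ε₂₉).εbg K g k)) (fieldMeasure (F.P K) k (SU 2)))
    (v : GaugeTransf (F.P K) (k + 1) (SU 2)) {W : GaugeField (F.P K) (k + 1) (SU 2)} (hWs : PlaqSmall ε₁ W)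
    (hWreg : (W : PBond (F.P K) (k + 1) → SU 2) ∈ regSetOfRecord F 2 K k
      (integrand (chiβOfRecord₁₃Ax F 2 (thetaFill F a₀ ε₂₉) K g k) (gfOfRecord F 2 K k) (g k)
        (ZeroInput.mainTermT F 2 (thetaFill F a₀ ε₂₉).εbg K g k))) :
    ZeroInput.zeroInputMergedTermT F 2 (TβOfRecord₁₃ F 2) (chiβOfRecord₁₃Ax F 2 (thetaFill F a₀ ε₂₉)) (thetaFill F a₀ ε₂₉).εbg K g k
        (gaugeAct v W) =
      ZeroInput.zeroInputMergedTermT F 2 (TβOfRecord₁₃ F 2) (chiβOfRecord₁₃Ax F 2 (thetaFill F a₀ ε₂₉)) (thetaFill F a₀ ε₂₉).εbg K g k W := by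
  have hk' : k + 1 ≤ (F.P K).m + (F.P K).K := by simp only [T4Continuum.T4Family.P_K]; omega
  have hDo : IsOpen {W : PBond (F.P K) (k + 1) → SU 2 | PlaqSmall ε₁ W} := isOpen_plaqSmall (P := F.P K) (j := k + 1) (N := 2) ε₁
  have hDst : ∀ (v : GaugeTransf (F.P K) (k + 1) (SU 2)) (V : GaugeField (F.P K) (k + 1) (SU 2)),
      V ∈ {W : PBond (F.P K) (k + 1) → SU 2 | PlaqSmall ε₁ W} → gaugeAct v V ∈ {W : PBond (F.P K) (k + 1) → SU 2 | PlaqSmall ε₁ W} :=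
    fun v V hV => (B12GaugeOrbits021.plaqSmall_gaugeAct_iff' ε₁ v V).2 hV
  have hTokE' : ∀ V : GaugeField (F.P K) (k + 1) (SU 2), PlaqSmall ε₁ V →
      UkExists F 2 K (k + 1) (thetaFill F a₀ ε₂₉).ν.εreg V ∧ UniqueUkOrbit F 2 K (k + 1) (thetaFill F a₀ ε₂₉).ν.εreg V := hTokE
  exact PortZD.zeroInputMergedTermT_gaugeAct_on_Tcan (N := 2) (chiβOfRecord₁₃Ax F 2 (thetaFill F a₀ ε₂₉)) (thetaFill F a₀ ε₂₉).εbg g hk hDo hDst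
    (fun v V hV => chiβOfRecord₁₃Ax_liftInvariantOn_of_tokE F (thetaFill F a₀ ε₂₉) hk' hTokE' g v V hV) hρ v ⟨hWs, hWreg⟩
    (hTokE W hWs).1 (hTokE _ ((B12GaugeOrbits021.plaqSmall_gaugeAct_iff' ε₁ v W).2 hWs)).2

end Summit.QuantumFields.YangMills.Theorems.PortZDRecord

end
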